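import Summits.RiemannHypothesis.RiemannHypothesis.Theorems.LiAsymptoticLiBoxTwoSided
import Summits.RiemannHypothesis.RiemannHypothesis.Theorems.LiHeightLawLogDefs
import HarnessLib

/-!
# RiemannHypothesis / LiHeightLog — crux `LiBoxCosh` (K1⁺), helper part (RH-FREE given the verified height):
# the COSH pair lemma and the cosh box comparison

Route `RiemannHypothesis/LiHeightLog` (round 6, rung L-P(P1-log) «Li HEIGHT LAW, LOGARITHMIC RANGE», cell `pub/rh-li`,
dossier `theory/route/r6/README-R6.md`), item `LiBoxCosh` (stmt-RiemannHypothesis-19648).  RH-FREE [rh-li-prover].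

* `BoxSplit.pair_cosh` (K1⁺a, the termwise COSH PAIR LEMMA, `n` UNRESTRICTED): for `0 ≤ Re ρ ≤ 1` and `Im ρ = γ ≥ 4`
  the reflected pair `{ρ, 1 − ρ̄}` of the Bombieri–Lagarias zero sum contributes `2 f_n(γ)` up to
  `liCoshWeight n γ + n/(2γ³)`:

    `|Re(1 − (1 − 1/ρ)ⁿ) + Re(1 − (1 − 1/(1 − ρ̄))ⁿ) − 2 f_n(γ)| ≤ G_n(γ) + n/(2γ³)`,

  `G_n(t) = liCoshWeight n t = (1 + 1/t²)^{n/2} + (1 + 1/t²)^{−n/2} − 2`.  With `w = 1 − 1/ρ`, `1 − 1/(1 − ρ̄) = 1/w̄`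
  and `x + iy = n log w` the pair is `2 − 2 cosh x cos y`, so `|pair − 2 f_n(γ)| ≤ 2(cosh x − 1) + 2|cos y − cos nθ(γ)|`;
  the second term is `≤ n/(2γ³)` by the tree's ANGLE LEMMA `abs_arg_one_sub_inv_sub_liZeroAngle_le` (exactly as in
  `pair_two_sided` of route `LiAsymptotic`), and the first is `≤ G_n(γ)` with NO restriction on `n`: the moduli
  `r = |w| = e^{x/n}` satisfy `r² = ((β − 1)² + γ²)/(β² + γ²)`, so `r^{±2} ≤ 1 + 1/γ²` for `0 ≤ β ≤ 1`
  (`BoxSplit.norm_sq_one_sub_inv_le`), i.e. `|x| ≤ n log √(1 + 1/γ²)`, and `cosh` is even and increasing in `|x|`.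
  This replaces the `2.82 n²/γ⁴` Taylor comparison of `pair_two_sided` (which needs `n ≤ γ²/4`).
* `liBoxCosh_bound` (K1⁺, the COSH BOX COMPARISON): for RH verified to `T ≥ 4`, `T ≤ T'` and EVERY `n`,
  `|Re Σ_{ρ ∈ liZeroBox T'} m(1 − (1 − 1/ρ)ⁿ) − 2 Σ_{0 < Im ρ ≤ T'} m f_n(Im ρ)|
     ≤ Σ_{T < Im ρ ≤ T'} m·G_n(Im ρ) + (n/2) Σ_{T < Im ρ ≤ T'} m/(Im ρ)³`
  — the K1b bookkeeping `BoxSplit.re_boxSum_eq` of `LiAsymptoticLiBoxTwoSided.lean` verbatim (conjugation doubles the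
  upper half-plane, `ρ ↦ 1 − ρ̄` is a multiplicity-preserving involution of `zerosBetween T T'`), on-line exactness
  `re_one_sub_pow_onLine` below `T`, and `pair_cosh` termwise above `T`.

Nothing here bears on the truth of RH: the only hypothesis is the FINITE verified height `RiemannHypothesisUpTo T`;
`pair_cosh` and `norm_sq_one_sub_inv_le` make no hypothesis on the real parts beyond `0 ≤ Re ρ ≤ 1`.
-/

noncomputable section

-- D-0017: `Summit.<S>.<S>.…` is the designed namespace of a single-problem summit.
set_option linter.dupNamespace false

open Complex Filter Set
open scoped Real ComplexConjugate Topology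

namespace Summit.RiemannHypothesis.RiemannHypothesis.Theorems.LiTheory

open Literature.NumberTheory.LFunctions Literature.NumberTheory.LFunctions.SchoenfeldBound
open Literature.NumberTheory.DiophantineGeometry

namespace BoxSplit

/-! ### The moduli of the reflected pair -/

/-- `a/d ≤ 1 + 1/g` when `0 < g ≤ d` and `a ≤ d + 1`. -/
private theorem div_le_one_add_one_div {a d g : ℝ} (hg : 0 < g) (hgd : g ≤ d) (ha : a ≤ d + 1) :
    a / d ≤ 1 + 1 / g := by
  have hd : 0 < d := hg.trans_le hgd
  calc a / d ≤ (d + 1) / d := div_le_div_of_nonneg_right ha hd.le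
    _ = 1 + 1 / d := by field_simp
    _ ≤ 1 + 1 / g := by
        have := one_div_le_one_div_of_le hg hgd
        linarith

/-- **The moduli of the reflected pair.**  For `0 ≤ Re ρ ≤ 1` and `Im ρ = γ > 0` the modulus `r = |1 − 1/ρ|`
satisfies `r² = ((Re ρ − 1)² + γ²)/((Re ρ)² + γ²)`, hence `r² ≤ 1 + 1/γ²` and `r⁻² ≤ 1 + 1/γ²`
(the reflected zero `1 − ρ̄` has modulus `|1 − 1/(1 − ρ̄)| = 1/r`). -/
theorem norm_sq_one_sub_inv_le {ρ : ℂ} (h0 : 0 ≤ ρ.re) (h1 : ρ.re ≤ 1) (hγ : 0 < ρ.im) :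
    ‖1 - 1 / ρ‖ ^ 2 ≤ 1 + 1 / ρ.im ^ 2 ∧ (‖1 - 1 / ρ‖ ^ 2)⁻¹ ≤ 1 + 1 / ρ.im ^ 2 := by
  set β := ρ.re with hβ
  set γ := ρ.im with hγdef
  have hρ0 : ρ ≠ 0 := by
    intro h
    rw [h, Complex.zero_im] at hγdef
    rw [hγdef] at hγ
    exact lt_irrefl _ hγ
  have hγ2 : 0 < γ ^ 2 := by positivity
  have hN : Complex.normSq ρ = β ^ 2 + γ ^ 2 := by rw [Complex.normSq_apply]; ring
  have hN1 : Complex.normSq (ρ - 1) = (β - 1) ^ 2 + γ ^ 2 := by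
    rw [Complex.normSq_apply, Complex.sub_re, Complex.one_re, Complex.sub_im, Complex.one_im, sub_zero]
    ring
  have hNpos : 0 < β ^ 2 + γ ^ 2 := by positivity
  have hN1pos : 0 < (β - 1) ^ 2 + γ ^ 2 := by positivity
  have hw : ‖1 - 1 / ρ‖ ^ 2 = ((β - 1) ^ 2 + γ ^ 2) / (β ^ 2 + γ ^ 2) := by
    have e : (1 : ℂ) - 1 / ρ = (ρ - 1) / ρ := by field_simp
    rw [e, norm_div, div_pow, Complex.sq_norm, Complex.sq_norm, hN, hN1]
  rw [hw, inv_div]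
  constructor
  · exact div_le_one_add_one_div hγ2 (by nlinarith) (by nlinarith)
  · exact div_le_one_add_one_div hγ2 (by nlinarith) (by nlinarith)

/-! ### The cosh pair -/

/-- **K1⁺a (the COSH pair lemma; `n` unrestricted).**  For `0 ≤ Re ρ ≤ 1` and `Im ρ = γ ≥ 4` the reflected pair
`{ρ, 1 − ρ̄}` contributes `2 f_n(γ)` up to `liCoshWeight n γ + n/(2γ³)`:
`|Re(1 − (1 − 1/ρ)ⁿ) + Re(1 − (1 − 1/(1 − ρ̄))ⁿ) − 2 f_n(γ)| ≤ G_n(γ) + n/(2γ³)`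
(`w = 1 − 1/ρ`, `1 − 1/(1 − ρ̄) = 1/w̄`: moduli `r, 1/r`, COMMON phase `arg w`; `rⁿ + r⁻ⁿ − 2 = 2(cosh(n log r) − 1) ≤ G_n(γ)`
because `r^{±2} ≤ 1 + 1/γ²`; the phase term by the angle lemma `abs_arg_one_sub_inv_sub_liZeroAngle_le`). -/
theorem pair_cosh (n : ℕ) {ρ : ℂ} (h0 : 0 ≤ ρ.re) (h1 : ρ.re ≤ 1) (h4 : 4 ≤ ρ.im) :
    |(1 - (1 - 1 / ρ) ^ n).re + (1 - (1 - 1 / (1 - conj ρ)) ^ n).re - 2 * liWindowWeight n ρ.im| ≤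
      liCoshWeight n ρ.im + (n : ℝ) / (2 * ρ.im ^ 3) := by
  set γ := ρ.im with hγdef
  have hγpos : 0 < γ := by linarith
  -- purely real preliminaries (before the complex bookkeeping enters the context)
  have hq4 : (ρ.re - 1 / 2) ^ 2 / γ ^ 3 ≤ 1 / (4 * γ ^ 3) := by
    rw [div_le_div_iff₀ (by positivity) (by positivity)]
    have hsq : (ρ.re - 1 / 2) ^ 2 ≤ 1 / 4 := by nlinarith [mul_nonneg h0 (sub_nonneg.2 h1)]
    have hγ3 : 0 < γ ^ 3 := by positivity
    nlinarith
  obtain ⟨hmodA, hmodB⟩ := norm_sq_one_sub_inv_le h0 h1 hγpos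
  rw [one_div] at hmodA hmodB
  -- the modulus scale `s = √(1 + 1/γ²)`: `liCoshWeight n γ = sⁿ + s⁻ⁿ − 2 = 2 cosh(n log s) − 2`
  obtain ⟨s, hs⟩ : ∃ s : ℝ, Real.sqrt (1 + 1 / γ ^ 2) = s := ⟨_, rfl⟩
  have hs_pos : 0 < s := by rw [← hs]; exact Real.sqrt_pos.2 (by positivity)
  have hG : liCoshWeight n γ = s ^ n + (s ^ n)⁻¹ - 2 := by rw [liCoshWeight, hs]
  have hcosh_s : 2 * Real.cosh (n * Real.log s) = s ^ n + (s ^ n)⁻¹ := by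
    rw [Real.cosh_eq, Real.exp_neg, Real.exp_nat_mul, Real.exp_log hs_pos]; ring
  have hγnorm : γ ≤ ‖ρ‖ := le_trans (le_abs_self _) (Complex.abs_im_le_norm ρ)
  have hnorm4 : (4 : ℝ) ≤ ‖ρ‖ := h4.trans hγnorm
  have hnorm_pos : 0 < ‖ρ‖ := by linarith
  have hρ0 : ρ ≠ 0 := norm_pos_iff.1 hnorm_pos
  have hρ1 : ρ ≠ 1 := by
    intro h; rw [h, norm_one] at hnorm4; norm_num at hnorm4
  -- `ε = ρ⁻¹`, `‖ε‖ ≤ 1/4 < 1`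
  have hεle : ‖(ρ⁻¹ : ℂ)‖ ≤ 1 / 4 := by
    rw [norm_inv, one_div]; exact inv_anti₀ (by norm_num) hnorm4
  have hεlt1 : ‖(ρ⁻¹ : ℂ)‖ < 1 := by linarith
  have hw0 : (1 : ℂ) - ρ⁻¹ ≠ 0 := by
    intro h
    have h' : ‖(ρ⁻¹ : ℂ)‖ = 1 := by rw [← sub_eq_zero.1 h]; simp
    linarith
  have hwpos : 0 < ‖(1 : ℂ) - ρ⁻¹‖ := norm_pos_iff.2 hw0
  -- `‖w‖ ≤ s` and `‖w‖⁻¹ ≤ s`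
  have hmodA' : ‖(1 : ℂ) - ρ⁻¹‖ ≤ s := by
    rw [← hs, ← Real.sqrt_sq hwpos.le]; exact Real.sqrt_le_sqrt hmodA
  have hmodB' : ‖(1 : ℂ) - ρ⁻¹‖⁻¹ ≤ s := by
    rw [← hs, ← Real.sqrt_sq (inv_nonneg.2 hwpos.le), inv_pow]; exact Real.sqrt_le_sqrt hmodB
  obtain ⟨L, hL⟩ : ∃ L : ℂ, Complex.log (1 - ρ⁻¹) = L := ⟨_, rfl⟩
  have hexpL : Complex.exp L = 1 - ρ⁻¹ := by rw [← hL]; exact Complex.exp_log hw0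
  have hwn : (1 - 1 / ρ) ^ n = Complex.exp (n * L) := by
    rw [Complex.exp_nat_mul, hexpL, one_div]
  have hc0 : conj ρ ≠ 0 := fun h ↦ hρ0 (by simpa using congrArg conj h)
  have hc1 : conj ρ ≠ 1 := fun h ↦ hρ1 (by simpa using congrArg conj h)
  have hw'n : (1 - 1 / (1 - conj ρ)) ^ n = conj (Complex.exp (-(n * L))) := by
    rw [Complex.exp_neg, Complex.exp_nat_mul, hexpL, map_inv₀, map_pow, map_sub, map_one,
      map_inv₀, ← inv_pow, one_sub_one_div_one_sub_eq hc0 hc1]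
  have hnL_re : ((n : ℂ) * L).re = n * L.re := by simp [Complex.mul_re]
  have hnL_im : ((n : ℂ) * L).im = n * L.im := by simp [Complex.mul_im]
  have hre1 : ((1 - 1 / ρ) ^ n).re = Real.exp (n * L.re) * Real.cos (n * L.im) := by
    rw [hwn, Complex.exp_re, hnL_re, hnL_im]
  have hre2 : ((1 - 1 / (1 - conj ρ)) ^ n).re =
      Real.exp (-(n * L.re)) * Real.cos (n * L.im) := by
    rw [hw'n, Complex.conj_re, Complex.exp_re, Complex.neg_re, Complex.neg_im, hnL_re, hnL_im,
      Real.cos_neg]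
  rw [Complex.sub_re, Complex.sub_re, Complex.one_re, hre1, hre2]
  -- the modulus: `L.re = log ‖w‖`, `|L.re| ≤ log s`
  have hLre : L.re = Real.log ‖(1 : ℂ) - ρ⁻¹‖ := by rw [← hL, Complex.log_re]
  have habsLre : |L.re| ≤ Real.log s := by
    rw [hLre, abs_le]
    constructor
    · have h := Real.log_le_log (inv_pos.2 hwpos) hmodB'
      rw [Real.log_inv] at h
      linarith
    · exact Real.log_le_log hwpos hmodA'
  obtain ⟨x, hx⟩ : ∃ x : ℝ, (n : ℝ) * L.re = x := ⟨_, rfl⟩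
  obtain ⟨y, hy⟩ : ∃ y : ℝ, (n : ℝ) * L.im = y := ⟨_, rfl⟩
  rw [hx, hy]
  have hn0' : (0 : ℝ) ≤ n := n.cast_nonneg
  -- `2(cosh x − 1) ≤ G_n(γ)` (cosh even and increasing in `|x|`, `|x| ≤ n log s`)
  have hxle : |x| ≤ |(n : ℝ) * Real.log s| := by
    rw [← hx, abs_mul, abs_mul, Nat.abs_cast]
    exact mul_le_mul_of_nonneg_left (habsLre.trans (le_abs_self _)) hn0'
  have hcosh_le : Real.cosh x ≤ Real.cosh (n * Real.log s) := Real.cosh_le_cosh.2 hxle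
  have hcoshG : 2 * (Real.cosh x - 1) ≤ liCoshWeight n γ := by
    rw [hG]; linarith
  have hcosh0 : 0 ≤ Real.cosh x - 1 := by linarith [Real.one_le_cosh x]
  -- the angle: `|y − n θ(γ)| ≤ n/(4γ³)`
  have hLim : L.im = Complex.arg (1 - 1 / ρ) := by rw [← hL, Complex.log_im, one_div]
  have hangle := abs_arg_one_sub_inv_sub_liZeroAngle_le h0 h1 h4
  have hyθ : |y - n * liZeroAngle γ| ≤ n / (4 * γ ^ 3) := by
    rw [← hy, hLim, ← mul_sub, abs_mul, Nat.abs_cast]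
    calc (n : ℝ) * |Complex.arg (1 - 1 / ρ) - liZeroAngle γ| ≤ n * (1 / (4 * γ ^ 3)) :=
          mul_le_mul_of_nonneg_left (hangle.trans hq4) hn0'
      _ = n / (4 * γ ^ 3) := by ring
  have hcos := Real.abs_cos_sub_cos_le y (n * liZeroAngle γ)
  -- assemble: the expression is `2(cos nθ − cos y) − 2(cosh x − 1) cos y`
  have hexpr : 1 - Real.exp x * Real.cos y + (1 - Real.exp (-x) * Real.cos y) - 2 * liWindowWeight n γ =
      -2 * (Real.cos y - Real.cos (n * liZeroAngle γ)) - 2 * (Real.cosh x - 1) * Real.cos y := by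
    rw [liWindowWeight, Real.cosh_eq]; ring
  rw [hexpr]
  have hcy := Real.abs_cos_le_one y
  have t1 : |-2 * (Real.cos y - Real.cos (n * liZeroAngle γ))| ≤ (n : ℝ) / (2 * γ ^ 3) := by
    rw [abs_mul, show |(-2 : ℝ)| = 2 by norm_num]
    have := hcos.trans hyθ
    have e : (n : ℝ) / (2 * γ ^ 3) = 2 * (n / (4 * γ ^ 3)) := by ring
    rw [e]
    exact mul_le_mul_of_nonneg_left this (by norm_num)
  have t2 : |2 * (Real.cosh x - 1) * Real.cos y| ≤ liCoshWeight n γ := by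
    rw [abs_mul, abs_of_nonneg (by linarith : (0 : ℝ) ≤ 2 * (Real.cosh x - 1))]
    calc 2 * (Real.cosh x - 1) * |Real.cos y| ≤ 2 * (Real.cosh x - 1) * 1 :=
          mul_le_mul_of_nonneg_left hcy (by linarith)
      _ ≤ liCoshWeight n γ := by linarith
  calc |-2 * (Real.cos y - Real.cos (n * liZeroAngle γ)) - 2 * (Real.cosh x - 1) * Real.cos y|
      ≤ |-2 * (Real.cos y - Real.cos (n * liZeroAngle γ))| + |2 * (Real.cosh x - 1) * Real.cos y| :=
        abs_sub _ _
    _ ≤ (n : ℝ) / (2 * γ ^ 3) + liCoshWeight n γ := add_le_add t1 t2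
    _ = liCoshWeight n γ + (n : ℝ) / (2 * γ ^ 3) := add_comm _ _

end BoxSplit

open BoxSplit

/-! ### The cosh box comparison -/

/-- **Crux `LiBoxCosh` (K1⁺; RH-free apart from the verified height), explicit form.**  For RH verified to `T`,
`4 ≤ T ≤ T'` and EVERY `n`:
`|Re Σ_{ρ ∈ liZeroBox T'} m(ρ)(1 − (1 − 1/ρ)ⁿ) − 2 Σ_{0 < Im ρ ≤ T'} m(ρ) f_n(Im ρ)|
  ≤ Σ_{T < Im ρ ≤ T'} m·liCoshWeight n (Im ρ) + (n/2) Σ_{T < Im ρ ≤ T'} m/(Im ρ)³`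
(`re_boxSum_eq` + on-line exactness `re_one_sub_pow_onLine` below `T` + `pair_cosh` termwise above `T`). -/
theorem liBoxCosh_bound :
    ∀ (n : ℕ) (T T' : ℝ), Literature.NumberTheory.DiophantineGeometry.RiemannHypothesisUpTo T → 4 ≤ T → T ≤ T' →
      |(∑ᶠ ρ ∈ Literature.NumberTheory.LFunctions.liZeroBox T',
            (Literature.NumberTheory.LFunctions.riemannZetaZeroOrder ρ : ℂ) * (1 - (1 - 1 / ρ) ^ n)).re
          - 2 * ∑ ρ ∈ Literature.NumberTheory.LFunctions.SchoenfeldBound.zerosBetween 0 T',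
              (Literature.NumberTheory.LFunctions.riemannZetaZeroOrder ρ : ℝ) *
                Summit.RiemannHypothesis.RiemannHypothesis.Theorems.LiTheory.liWindowWeight n ρ.im|
        ≤ (∑ ρ ∈ Literature.NumberTheory.LFunctions.SchoenfeldBound.zerosBetween T T',
              (Literature.NumberTheory.LFunctions.riemannZetaZeroOrder ρ : ℝ) *
                Summit.RiemannHypothesis.RiemannHypothesis.Theorems.LiTheory.liCoshWeight n ρ.im)
          + (n : ℝ) / 2 *
              (∑ ρ ∈ Literature.NumberTheory.LFunctions.SchoenfeldBound.zerosBetween T T',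
                (Literature.NumberTheory.LFunctions.riemannZetaZeroOrder ρ : ℝ) / ρ.im ^ 3) := by
  intro n T T' hRH hT4 hTT'
  have hT0 : (0 : ℝ) ≤ T := by linarith
  rw [re_boxSum_eq n hT0 hTT']
  -- on-line terms below T
  have hcongr : ∑ ρ ∈ zerosBetween 0 T, (riemannZetaZeroOrder ρ : ℝ) * (1 - (1 - 1 / ρ) ^ n).re =
      ∑ ρ ∈ zerosBetween 0 T, (riemannZetaZeroOrder ρ : ℝ) * liWindowWeight n ρ.im := by
    refine Finset.sum_congr rfl fun ρ hρ ↦ ?_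
    obtain ⟨hz, -, -, h3, h4⟩ := (mem_zerosBetween le_rfl).1 hρ
    rw [re_one_sub_pow_onLine n (hRH ρ hz h3 h4) (ne_of_gt h3)]
  rw [hcongr, sum_zerosBetween_split_at hT0 hTT' (fun ρ ↦ (riemannZetaZeroOrder ρ : ℝ) * liWindowWeight n ρ.im)]
  -- the difference is the sum of the pair errors above T
  have hdiff : 2 * (∑ ρ ∈ zerosBetween 0 T, (riemannZetaZeroOrder ρ : ℝ) * liWindowWeight n ρ.im) +
        (∑ ρ ∈ zerosBetween T T', (riemannZetaZeroOrder ρ : ℝ) *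
          ((1 - (1 - 1 / ρ) ^ n).re + (1 - (1 - 1 / (1 - conj ρ)) ^ n).re)) -
        2 * ((∑ ρ ∈ zerosBetween 0 T, (riemannZetaZeroOrder ρ : ℝ) * liWindowWeight n ρ.im) +
          ∑ ρ ∈ zerosBetween T T', (riemannZetaZeroOrder ρ : ℝ) * liWindowWeight n ρ.im) =
      ∑ ρ ∈ zerosBetween T T', (riemannZetaZeroOrder ρ : ℝ) *
        ((1 - (1 - 1 / ρ) ^ n).re + (1 - (1 - 1 / (1 - conj ρ)) ^ n).re - 2 * liWindowWeight n ρ.im) := by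
    rw [show ∑ ρ ∈ zerosBetween T T', (riemannZetaZeroOrder ρ : ℝ) *
        ((1 - (1 - 1 / ρ) ^ n).re + (1 - (1 - 1 / (1 - conj ρ)) ^ n).re - 2 * liWindowWeight n ρ.im) =
        ∑ ρ ∈ zerosBetween T T', ((riemannZetaZeroOrder ρ : ℝ) *
          ((1 - (1 - 1 / ρ) ^ n).re + (1 - (1 - 1 / (1 - conj ρ)) ^ n).re) -
          2 * ((riemannZetaZeroOrder ρ : ℝ) * liWindowWeight n ρ.im)) from
        Finset.sum_congr rfl fun ρ _ ↦ by ring,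
      Finset.sum_sub_distrib, ← Finset.mul_sum]
    ring
  rw [hdiff]
  -- termwise bound
  have hkey : ∀ ρ ∈ zerosBetween T T',
      |(riemannZetaZeroOrder ρ : ℝ) *
        ((1 - (1 - 1 / ρ) ^ n).re + (1 - (1 - 1 / (1 - conj ρ)) ^ n).re - 2 * liWindowWeight n ρ.im)| ≤
        (riemannZetaZeroOrder ρ : ℝ) * liCoshWeight n ρ.im +
          (n : ℝ) / 2 * ((riemannZetaZeroOrder ρ : ℝ) / ρ.im ^ 3) := by
    intro ρ hρ
    obtain ⟨-, h0, h1', h3, -⟩ := (mem_zerosBetween hT0).1 hρ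
    have hγ4 : 4 ≤ ρ.im := by linarith
    have hγpos : 0 < ρ.im := by linarith
    have hp := pair_cosh n h0 h1' hγ4
    have hρ1 : ρ ≠ 1 := fun h ↦ by rw [h, Complex.one_im] at hγpos; exact lt_irrefl _ hγpos
    have hm : (0 : ℝ) ≤ (riemannZetaZeroOrder ρ : ℝ) := by
      exact_mod_cast riemannZetaZeroOrder_nonneg hρ1
    rw [abs_mul, abs_of_nonneg hm]
    have := mul_le_mul_of_nonneg_left hp hm
    have hrew : (riemannZetaZeroOrder ρ : ℝ) * (liCoshWeight n ρ.im + (n : ℝ) / (2 * ρ.im ^ 3)) =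
        (riemannZetaZeroOrder ρ : ℝ) * liCoshWeight n ρ.im +
          (n : ℝ) / 2 * ((riemannZetaZeroOrder ρ : ℝ) / ρ.im ^ 3) := by
      field_simp
    linarith [hrew]
  refine (Finset.abs_sum_le_sum_abs _ _).trans ?_
  refine (Finset.sum_le_sum hkey).trans (le_of_eq ?_)
  simp only [Finset.sum_add_distrib, Finset.mul_sum]

end Summit.RiemannHypothesis.RiemannHypothesis.Theorems.LiTheory

end
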